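import Literature.Topology.FourManifolds.LevelFlowExtension
import HarnessLib

/-!
# Correcting a lower pair by a level-preserving, flow-commuting diffeomorphism

Topic `Literature/Topology/FourManifolds` (fact seat
`provefact-Literature.Topology.FourManifolds.IsHandlebody.exists_diffeomorph_isBoundaryGluing_sphere`,
step F2b₁ of the Lickorish–Wallace DAG; level step H2 of the reduction of L1
`oneHandle_nonempty_diffeomorphism`: the seed lower pair (`IsLowerPair.seed`,
`LevelFlowExtension.lean`) is corrected on the feet of the handle by post-composition with the
suspension of a level diffeotopy (`LevelDiffeotopySuspension.lean`); this file records that such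
a correction is again a lower pair).  Everything here is **proved**; no named facts.

`IsLowerPair.postcomp`: if `(g, g')` is a lower pair at the level `a`, width `η`, shift `σ`
(`Literature.Topology.FourManifolds.IsLowerPair`) and `κ` is a diffeomorphism of `M'` preserving
`f'` and commuting with the flow `θ'` on the collar `f'⁻¹(a + σ - 5η, a + σ - η)`, then
`(κ ∘ g, g' ∘ κ⁻¹)` is a lower pair with the same parameters (every axiom is checked directly;
the conjugation of the inverse maps follows from that of the maps).

## References

* J. Milnor, *Lectures on the h-cobordism theorem* (1965), proof of Thm. 3.13 (PDF pp. 18–19).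
  [MilnorHCobordism1965]
-/

open scoped Manifold ContDiff Topology
open Set Function Filter

noncomputable section

namespace Literature.Topology.FourManifolds

universe u

variable {n : ℕ} {M : Type u} [TopologicalSpace M] [ChartedSpace (EuclideanHalfSpace (n + 1)) M]
  {M' : Type u} [TopologicalSpace M'] [ChartedSpace (EuclideanHalfSpace (n + 1)) M']
  {S : UnitSlab (n := n) M} {S' : UnitSlab (n := n) M'} {σ a η : ℝ} {g : M → M'} {g' : M' → M}

/-- **Post-composition of a lower pair with a level-preserving diffeomorphism commuting with
the flow on the collar is a lower pair.** [cite: MilnorHCobordism1965, proof of Thm. 3.13 (PDF pp. 18–19)] -/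
theorem IsLowerPair.postcomp (h : IsLowerPair S S' σ a η g g') (hη : 0 < η) (κ : M' ≃ₘ⟮𝓡∂ (n + 1), 𝓡∂ (n + 1)⟯ M')
    (hκf : ∀ y, S'.f (κ y) = S'.f y)
    (hκflow : ∀ y t, S'.f y ∈ Ioo (a + σ - 5 * η) (a + σ - η) → S'.f y + t ∈ Ioo (a + σ - 5 * η) (a + σ - η) →
      κ (S'.θ (t, y)) = S'.θ (t, κ y)) :
    IsLowerPair S S' σ a η (κ ∘ g) (g' ∘ κ.symm) := by
  have hκf' : ∀ y, S'.f (κ.symm y) = S'.f y := fun y => by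
    have := hκf (κ.symm y); rw [Diffeomorph.apply_symm_apply] at this; exact this.symm
  -- the inverse commutes with the flow on the collar as well
  have hκflow' : ∀ y t, S'.f y ∈ Ioo (a + σ - 5 * η) (a + σ - η) →
      S'.f y + t ∈ Ioo (a + σ - 5 * η) (a + σ - η) → κ.symm (S'.θ (t, y)) = S'.θ (t, κ.symm y) := by
    intro y t hy ht
    have h1 := hκflow (κ.symm y) t (by rw [hκf']; exact hy) (by rw [hκf']; exact ht)
    rw [Diffeomorph.apply_symm_apply] at h1
    rw [← h1, Diffeomorph.symm_apply_apply]
  refine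
    { g_smooth := κ.contMDiff.comp_contMDiffOn h.g_smooth
      g'_smooth := h.g'_smooth.comp κ.symm.contMDiff.contMDiffOn fun y hy => ?_
      apply_g := fun x hx => by rw [comp_apply, hκf, h.apply_g x hx]
      apply_g' := fun y hy => by rw [comp_apply, h.apply_g' _ (by rw [hκf']; exact hy), hκf']
      g_below := fun x hx => by rw [comp_apply, hκf]; exact h.g_below x hx
      g'_below := fun y hy => by rw [comp_apply]; exact h.g'_below _ (by rw [hκf']; exact hy)
      g'_g := fun x hx => by rw [comp_apply, comp_apply, Diffeomorph.symm_apply_apply, h.g'_g x hx]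
      g_g' := fun y hy => by rw [comp_apply, comp_apply, h.g_g' _ (by rw [hκf']; exact hy), Diffeomorph.apply_symm_apply]
      g_flow := fun x t hx ht => ?_
      g'_flow := fun y t hy ht => ?_ }
  · show S'.f (κ.symm y) < a + σ
    have hy' : S'.f y < a + σ := hy
    rwa [hκf']
  · rw [comp_apply, comp_apply, h.g_flow x t hx ht]
    have hgx : S'.f (g x) = S.f x + σ := h.apply_g x ⟨by linarith [hx.1], by linarith [hx.2, ht.2, hx.1]⟩
    exact hκflow (g x) t (by rw [hgx]; exact ⟨by linarith [hx.1], by linarith [hx.2]⟩)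
      (by rw [hgx]; exact ⟨by linarith [ht.1], by linarith [ht.2]⟩)
  · rw [comp_apply, comp_apply, hκflow' y t hy ht]
    exact h.g'_flow _ t (by rw [hκf']; exact hy) (by rw [hκf']; exact ht)

end Literature.Topology.FourManifolds
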